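import Literature.Barriers.CriticalPhenomena.PlaquetteWalkHoleRootRootNotchEast
import HarnessLib

/-!
# Barrier catalogue (SAWScalingLimit): ONE ROUTE EMPTY — the weak signs of the far-cell defect without witnesses

Leaf of `PlaquetteWalkHoleRootRootNotchEast` (§2, the one-route tools: `ΩG.sum_routeMassW_eq_zero_of_unwound`, and the strict signs
`im_vertexFunctional_printed_pos_of_under_unwound` / `…_neg_of_over_unwound`, which need over- resp. under-witnesses of BOTH freeness
classes at every angle). The lane's emptiness theorems (dead door, root notch, one live column / row, east shut, the bent cuts of
`PlaquetteWalkHoleRootCutLaw`, the third-side law of `PlaquetteWalkHoleRootCutMarkingDoors`, …) all conclude «every class-`B2a` under-walk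
(resp. over-walk) at the far cell is unwound». This file records what follows for the Yang–Baxter vertex functional at the far cell with NO
witness at all, and with ONE witness at one angle:

* ★★★ `im_vertexFunctional_printed_nonneg_of_under_unwound` — under route unwound at `θ` ⇒ `Im VF(θ) ≥ 0` (`VF = i·v·M_N`, `v > 0`, masses
  non-negative); ★★★ `im_vertexFunctional_printed_nonpos_of_over_unwound` — over route unwound ⇒ `Im VF(θ) ≤ 0`.
* ★★★ `im_vertexFunctional_printed_pos_of_under_unwound_of_wound_over` — under route unwound and ONE wound over-walk at an interior angle
  `θ ∈ (π/3, 2π/3)` ⇒ `Im VF(θ) > 0`; twin `…_neg_of_over_unwound_of_wound_under`.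
* ★★★ `vertexFunctional_printed_eq_zero_of_both_unwound` — both routes unwound at `θ` ⇒ `VF(θ) = 0`;
  `re_vertexFunctional_printed_eq_zero` is not claimed (the real part carries the chord terms).
* ★★ `im_vertexFunctional_printed_ne_zero_iff_of_under_unwound` — under route unwound ⇒ (`Im VF(θ) ≠ 0` ⇔ some over-walk is wound at `θ`
  with non-zero weight), in the form `0 < Im VF ↔ 0 < M_N`.

So every emptiness theorem yields a definite weak sign on the whole range `[π/3, 2π/3]`, strict exactly where the other route carries mass.

Not in print; venture lane «pcv-sawmu», seat b-step0 gen 29.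

References: A. Glazman, I. Manolescu, arXiv:1708.00395v3, §1 eq. (1) (the weights are non-negative on `[π/3, 2π/3]`), Lemma 2.1
[GlazmanManolescu2019]; A. Glazman, Electron. Commun. Probab. 20 (2015) no. 86, Lemma 3.1, proof pp. 6–7 [Glazman2015WeightedSAW];
H. Duminil-Copin, S. Smirnov, Ann. of Math. 175 (2012), proof of Lemma 1 (the vertex relation as a sum over classes of walks)
[DuminilCopinSmirnov2012].
-/

noncomputable section

open Set Function Complex

namespace Literature.Barriers.CriticalPhenomena.PlaquetteWalk

open Literature.Probability.RandomPlanarGeometry.SAW.YangBaxter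
open Real Complex

section OneRoute

variable {Dl : List Face} {w : Face}

/-- ★★★ **UNDER ROUTE UNWOUND ⇒ `Im VF(θ) ≥ 0`.** If every class-`B2a` under-walk (first side `S`) at the far cell is unwound at `θ`, the
imaginary part of the Yang–Baxter vertex functional at the far cell is `v(θ)·M_N(θ) ≥ 0`.
[cite: GlazmanManolescu2019, Lemma 2.1 (statement, "in the form given in [Gl]"), §1 eq. (1)]
[cite: Glazman2015WeightedSAW, Lemma 3.1 (proof, pp. 6–7)] -/
theorem im_vertexFunctional_printed_nonneg_of_under_unwound {θ : ℝ} (hθ : θ ∈ Set.Icc (π / 3) (2 * π / 3))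
    (hf : farW w ∈ Dl) (hh : holeFaceW w ∉ dom Dl) (hr : RootedFace (dom Dl) (w.side .W) (farW w))
    (hU : ∀ (ω : ΩG (dom Dl) (w.side .W) (farW w)) (h : ω.IsB2a), ω.2.firstSideG = .S →
      ω.WE (fun _ => θ) = excursionWinding θ ω.2.firstSideG (ω.z1 hr h) ω.1) :
    0 ≤ (vertexFunctional (printedWeights θ) tFiveEighths (ybCoeff θ) Dl (w.side .W) (farW w)).im := by
  rw [vertexFunctional_printed_farCellW_im_eq hθ Dl w hf hh hr, ΩG.sum_routeMassW_eq_zero_of_unwound hr .S θ hU, sub_zero]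
  exact mul_nonneg (weightV_pos_of_mem hθ).le (Finset.sum_nonneg fun ω _ => ΩG.routeMassW_nonneg hθ hr .N ω)

/-- ★★★ **OVER ROUTE UNWOUND ⇒ `Im VF(θ) ≤ 0`** (`Im VF = −v(θ)·M_S(θ)`).
[cite: GlazmanManolescu2019, Lemma 2.1 (statement, "in the form given in [Gl]"), §1 eq. (1)]
[cite: Glazman2015WeightedSAW, Lemma 3.1 (proof, pp. 6–7)] -/
theorem im_vertexFunctional_printed_nonpos_of_over_unwound {θ : ℝ} (hθ : θ ∈ Set.Icc (π / 3) (2 * π / 3))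
    (hf : farW w ∈ Dl) (hh : holeFaceW w ∉ dom Dl) (hr : RootedFace (dom Dl) (w.side .W) (farW w))
    (hU : ∀ (ω : ΩG (dom Dl) (w.side .W) (farW w)) (h : ω.IsB2a), ω.2.firstSideG = .N →
      ω.WE (fun _ => θ) = excursionWinding θ ω.2.firstSideG (ω.z1 hr h) ω.1) :
    (vertexFunctional (printedWeights θ) tFiveEighths (ybCoeff θ) Dl (w.side .W) (farW w)).im ≤ 0 := by
  rw [vertexFunctional_printed_farCellW_im_eq hθ Dl w hf hh hr, ΩG.sum_routeMassW_eq_zero_of_unwound hr .N θ hU, zero_sub,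
    mul_neg, neg_nonpos]
  exact mul_nonneg (weightV_pos_of_mem hθ).le (Finset.sum_nonneg fun ω _ => ΩG.routeMassW_nonneg hθ hr .S ω)

/-- ★★★ **UNDER ROUTE UNWOUND + ONE WOUND OVER-WALK AT AN INTERIOR ANGLE ⇒ `Im VF(θ) > 0`.**
[cite: GlazmanManolescu2019, Lemma 2.1 (statement, "in the form given in [Gl]"), §1 eq. (1)]
[cite: Glazman2015WeightedSAW, Lemma 3.1 (proof, pp. 6–7)] -/
theorem im_vertexFunctional_printed_pos_of_under_unwound_of_wound_over {θ : ℝ} (hθ : θ ∈ Set.Ioo (π / 3) (2 * π / 3))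
    (hf : farW w ∈ Dl) (hh : holeFaceW w ∉ dom Dl) (hr : RootedFace (dom Dl) (w.side .W) (farW w))
    (hU : ∀ (ω : ΩG (dom Dl) (w.side .W) (farW w)) (h : ω.IsB2a), ω.2.firstSideG = .S →
      ω.WE (fun _ => θ) = excursionWinding θ ω.2.firstSideG (ω.z1 hr h) ω.1)
    (hO : ∃ (ω : ΩG (dom Dl) (w.side .W) (farW w)) (h : ω.IsB2a), ω.2.firstSideG = .N ∧
      ω.WE (fun _ => θ) ≠ excursionWinding θ ω.2.firstSideG (ω.z1 hr h) ω.1) :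
    0 < (vertexFunctional (printedWeights θ) tFiveEighths (ybCoeff θ) Dl (w.side .W) (farW w)).im := by
  have hθ' : θ ∈ Set.Icc (π / 3) (2 * π / 3) := ⟨hθ.1.le, hθ.2.le⟩
  rw [vertexFunctional_printed_farCellW_im_eq hθ' Dl w hf hh hr, ΩG.sum_routeMassW_eq_zero_of_unwound hr .S θ hU, sub_zero]
  exact mul_pos (weightV_pos_of_mem hθ') (ΩG.sum_routeMassW_pos_of_wound hr .N hθ hO)

/-- ★★★ **OVER ROUTE UNWOUND + ONE WOUND UNDER-WALK AT AN INTERIOR ANGLE ⇒ `Im VF(θ) < 0`.**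
[cite: GlazmanManolescu2019, Lemma 2.1 (statement, "in the form given in [Gl]"), §1 eq. (1)]
[cite: Glazman2015WeightedSAW, Lemma 3.1 (proof, pp. 6–7)] -/
theorem im_vertexFunctional_printed_neg_of_over_unwound_of_wound_under {θ : ℝ} (hθ : θ ∈ Set.Ioo (π / 3) (2 * π / 3))
    (hf : farW w ∈ Dl) (hh : holeFaceW w ∉ dom Dl) (hr : RootedFace (dom Dl) (w.side .W) (farW w))
    (hU : ∀ (ω : ΩG (dom Dl) (w.side .W) (farW w)) (h : ω.IsB2a), ω.2.firstSideG = .N →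
      ω.WE (fun _ => θ) = excursionWinding θ ω.2.firstSideG (ω.z1 hr h) ω.1)
    (hS : ∃ (ω : ΩG (dom Dl) (w.side .W) (farW w)) (h : ω.IsB2a), ω.2.firstSideG = .S ∧
      ω.WE (fun _ => θ) ≠ excursionWinding θ ω.2.firstSideG (ω.z1 hr h) ω.1) :
    (vertexFunctional (printedWeights θ) tFiveEighths (ybCoeff θ) Dl (w.side .W) (farW w)).im < 0 := by
  have hθ' : θ ∈ Set.Icc (π / 3) (2 * π / 3) := ⟨hθ.1.le, hθ.2.le⟩
  rw [vertexFunctional_printed_farCellW_im_eq hθ' Dl w hf hh hr, ΩG.sum_routeMassW_eq_zero_of_unwound hr .N θ hU, zero_sub,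
    mul_neg, neg_lt_zero]
  exact mul_pos (weightV_pos_of_mem hθ') (ΩG.sum_routeMassW_pos_of_wound hr .S hθ hS)

/-- ★★★ **BOTH ROUTES UNWOUND AT `θ` ⇒ `VF(θ) = 0`** (the vertex relation holds at the far cell of the hole root at that angle).
[cite: GlazmanManolescu2019, Lemma 2.1 (statement, "in the form given in [Gl]")] [cite: Glazman2015WeightedSAW, Lemma 3.1 (proof, pp. 6–7)]
[cite: DuminilCopinSmirnov2012, proof of Lemma 1 (the relation as a sum over classes of walks)] -/
theorem vertexFunctional_printed_eq_zero_of_both_unwound {θ : ℝ} (hθ : θ ∈ Set.Icc (π / 3) (2 * π / 3))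
    (hf : farW w ∈ Dl) (hh : holeFaceW w ∉ dom Dl)
    (hU : ∀ (hr : RootedFace (dom Dl) (w.side .W) (farW w)) (ω : ΩG (dom Dl) (w.side .W) (farW w)) (h : ω.IsB2a),
      ω.WE (fun _ => θ) = excursionWinding θ ω.2.firstSideG (ω.z1 hr h) ω.1) :
    vertexFunctional (printedWeights θ) tFiveEighths (ybCoeff θ) Dl (w.side .W) (farW w) = 0 := by
  have hr : RootedFace (dom Dl) (w.side .W) (farW w) := ⟨hf, fun hb => hh (by rw [root_faces_W] at hb; exact hb.1)⟩
  rw [vertexFunctional_printed_farCellW_eq hθ Dl w hf hh hr,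
    ΩG.sum_routeMassW_eq_zero_of_unwound hr .S θ (fun ω h _ => hU hr ω h),
    ΩG.sum_routeMassW_eq_zero_of_unwound hr .N θ (fun ω h _ => hU hr ω h)]
  simp

/-- ★★ **UNDER ROUTE UNWOUND ⇒ (`Im VF(θ) > 0` ⇔ the over route has positive mass at `θ`).**
[cite: GlazmanManolescu2019, Lemma 2.1 (statement, "in the form given in [Gl]"), §1 eq. (1)]
[cite: Glazman2015WeightedSAW, Lemma 3.1 (proof, pp. 6–7)] -/
theorem im_vertexFunctional_printed_pos_iff_of_under_unwound {θ : ℝ} (hθ : θ ∈ Set.Icc (π / 3) (2 * π / 3))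
    (hf : farW w ∈ Dl) (hh : holeFaceW w ∉ dom Dl) (hr : RootedFace (dom Dl) (w.side .W) (farW w))
    (hU : ∀ (ω : ΩG (dom Dl) (w.side .W) (farW w)) (h : ω.IsB2a), ω.2.firstSideG = .S →
      ω.WE (fun _ => θ) = excursionWinding θ ω.2.firstSideG (ω.z1 hr h) ω.1) :
    0 < (vertexFunctional (printedWeights θ) tFiveEighths (ybCoeff θ) Dl (w.side .W) (farW w)).im ↔
      0 < ∑ ω ∈ ΩG.setB2a (dom Dl) (w.side .W) (farW w), ΩG.routeMassW θ hr .N ω := by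
  rw [vertexFunctional_printed_farCellW_im_eq hθ Dl w hf hh hr, ΩG.sum_routeMassW_eq_zero_of_unwound hr .S θ hU, sub_zero]
  constructor
  · intro h
    by_contra hn
    push Not at hn
    have := mul_nonpos_of_nonneg_of_nonpos (weightV_pos_of_mem hθ).le hn
    linarith
  · intro h
    exact mul_pos (weightV_pos_of_mem hθ) h

end OneRoute

end Literature.Barriers.CriticalPhenomena.PlaquetteWalk
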